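import Literature.MathematicalPhysics.QuantumFieldTheory.Balaban1983to89.B8Lemma1NonAbelian
import Literature.MathematicalPhysics.QuantumFieldTheory.Balaban1983to89.B8Eq140Level
import Literature.MathematicalPhysics.QuantumFieldTheory.Balaban1983to89.B7Prop9General
import Literature.MathematicalPhysics.QuantumFieldTheory.Balaban1983to89.B8Eq115GaugeFixing

/-!
# `Balaban1983to89.B8LayerAxialGauge` — [Balaban1985RegularSpaces] Lemma 1 p. 79 ∕ [Balaban1985Averaging] p. 24: AN AXIAL GAUGE FOR THE PLAQUETTES
# TOUCHING A BOX.  From `|U(∂p) − 1| ≤ α` for the plaquettes with a corner in the box `□` ONLY (p. 77's «p ∈ Ω» convention, the level-`0` clause of (1.7)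
# for `Ω₀ = □`), a gauge transformation `u` built from `U` makes `|U^u(b) − 1| ≤ (|□|₁ + 1)·α` on every side `b` of every plaquette touching `□`; hence
# the TRANSFER SCHEMA «uniform ball + gauge covariance + locality on those sides ⟹ every background of p. 77's class at `Ω₀ = □`»

statement-level skeleton of published theorems with citation tags; proofs where landed; nothing here is a claim about the
Yang–Mills mass gap

`[Balaban1985RegularSpaces]` ("B8", CMP **99** (1985) 75–102) p. 77 (the touching convention; `𝔄_k({Ω_j}, α₀)`, (1.7)), Lemma 1 p. 79 («The conditions
`(R₀V′)(Γ_{y,x}) = 1` … imply `V′_b = 1` for `b ⊂ Γ_{y,x}`. This and the above estimate imply `|V′_b − 1| < (d−1)(L−1)2α₀L⁻²` … by the same reasoning as in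
[3]»), (1.11) p. 78 (gauge invariance of `𝔄_k`); [B7] = `[Balaban1985Averaging]` (CMP **98** (1985) 17–51) p. 24 («Let us fix the axial gauge … the gauge
transformed configuration `V₀ = V^{v₀}` satisfies the conditions `V₀(Γ_{y,x}) = 1` … `|V₀(x, x + e₂) − 1| < |x₁ − y₁|α₀, …»), (8)–(9) p. 18.

CITATION HEADER (lean-in-tree rule).  Cell `pub-ymgap` (YM Track A, HUMAN RULING D-0062 ∕ D-0149), DAG node N05 = [B8], width seat `pub-ymgap-dag-n05-w3`
(g3), CLAIM-1 file (L).  WHY.  The per-member curved (1.59) of this seat (files (D)–(H), g2) reaches print's class only on a NEIGHBOURHOOD box `□₀ + (L+4)`,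
because `B8Lemma1NonAbelian.axial_bond_bound_sharp` (the tree's Lemma 1 ∕ [B7] p. 24 axial gauge) controls the bonds of a box from the plaquettes INSIDE it,
while the member's data read `U₀` on the sides of the plaquettes TOUCHING `□₀` (file (R)), some of which stick out of `□₀`.  THIS FILE closes that gap with a
LAYER gauge: Lemma 1's axial gauge `V := U^{v₀}` on `□ = [lo, hi]` (tree bonds `= 1`, the other bonds of `□` within `|□|₁·α`), followed by the CLAMPING
gauge `w(v) := V(Γ_{π(v), v})` (`π` = the coordinatewise retraction `B7Prop1Local.clamp`, `Γ` the tree contour of `B7Prop1Explicit.treeWord`): every side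
`b` of a plaquette touching `□` then carries `V^w(b) =` (a unit square based at a point of `□`, possibly degenerate) `×` (a bond of `□` or `1`), so
`|V^w(b) − 1| ≤ α + |□|₁·α` — using ONLY plaquettes with a corner in `□`.

THE MATHEMATICS (kernel-checked, [folklore] lattice kinematics arranged after [B7] p. 24).  §1 `hol_rotate` ∕ `norm_hol_rotate_sub_one_le` (a closed word read
from another of its points is a conjugate), `hol_cons_true_false` ∕ `hol_cons_false_true` (backtracking), ★ `norm_hol_square_sub_one_le` (each of the eight
unit-square words based at a point `c ∈ S` is within `α` of `1` if the plaquettes touching `S` are: rotations of `p_{ab}`, `p_{ba}` at the lower corner);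
§2 `treeWord_two` (the tree contour of `s e_σ + t e_τ`), `clampGauge_bond` (the bond formula `V^w(x, τ) = V(Γ_{π x, x} ∪ ⟨x, x+e_τ⟩ ∪ Γ_{x+e_τ, π(x+e_τ)}⁻¹)`);
§3 `exists_corner_of_sideTouches` (a side of a plaquette touching `S` differs from a point of `S` by `≤ 1` in one direction `σ ≠ τ` and by `0 ∕ −1` in `τ`),
★ `clamp_trichotomy` (for the box: `x − π x = s e_σ + t e_τ`, `|s| ≤ 1`, with (`t = 0`, `π(x+e_τ) = π x + e_τ`) or (`t = −1`, `π(x+e_τ) = π x`) or (`t = 0`,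
`π(x + e_τ) = π x`)); §4 ★★ `norm_clampGauge_sub_one_le` (`|V^w(b) − 1| ≤ α + β` on the sides of the touching plaquettes if `V`'s touching plaquettes are
`α`-small and its bonds inside `□` are `β`-close to `1`), ★★ `exists_layerGauge` (with Lemma 1's axial gauge first: `∃ u` valued in any subgroup containing the
values of `U`, `|U^u(b) − 1| ≤ (|hi − lo|₁ + 1)·α` on every side of every plaquette touching `□`); §5 ★★★ `of_touching_plaquettes` — THE TRANSFER SCHEMA: for a
property `P` of `H`-valued bond fields (`H ≤ U1`) such that (BG) `P(V^u)` for every `u` and every `H`-valued `V` uniformly `δ`-close to `1`, and (L) `P` only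
reads the sides of the plaquettes touching `□`, EVERY `H`-valued `U` whose plaquettes touching `□` are `δ∕(|hi − lo|₁ + 1)`-small has `P` (cut `U^u` off to `1`
outside those sides, pull back along `u⁻¹`); §6 (v1.1 append) ★★★ `of_touching_plaquettes_H` ((BG) asked for `H`-valued `u` only) and ★★★ `of_touching_plaquettes_BGL`
(the three legs separated: (B) uniform ball, (G) pull-back `P(U^u) → P(U)`, (L) locality — the N06 «IDEA-3.11 (iv)» shape with `SideTouches` locality).

HONEST SCOPE ∕ A6.  Kinematics only ([folklore]); `α` per box (the factor `|hi − lo|₁ + 1` is the tree's comb-gauge constant, not print's `4d²`); the schema's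
`δ` is whatever the consumer's uniform-ball theorem gives (per member in this seat's files).  Non-vacuity: `U = 1`.  Count-neutral; N05 NOT discharged; no
count claim; one finite `𝕋⁴` programme at fixed `ε`, Bałaban as printed; the YM mass gap (Clay) is NOT proved by any of this — R4 closes the conditional
finite-`𝕋⁴` rung `BalabanLadder.UV` only; nothing continuum ∕ ℝ⁴ ∕ OS.  No `sorry`, no `def`, no `instance`, no `notation`.  Unit `pub-ymgap-dag-n05-w3` (g3),
2026-08-28.
-/

noncomputable section

namespace Literature.MathematicalPhysics.QuantumFieldTheory.Balaban1983to89.B8LayerAxialGauge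

open B7Prop1Explicit B7Prop2Explicit B7Prop1Local
open B8Ineq132 (PlaqTouches BondTouches plaqF)
open B8Eq140Level (SideTouches IsSide)
open B8Lemma1NonAbelian (lowPart axial_bond_bound_sharp zsmul_e_apply treeWord_zsmul_e)
open B7Prop9General (treeWord_split hiPart loPart)
open B8Eq115GaugeFixing (gaugeAct_mem_of)

-- `Site` alone would resolve to the torus sites of `Setup.lean`; re-export the `ℤ^d` sites of `B7Prop1Explicit`.
export B7Prop1Explicit (Site)

variable {d : ℕ}

/-! ## §1 Closed words read from another point; backtracking; the eight unit squares at a point -/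

section Words

variable {G : Type*} [Group G]

/-- **A closed word read from another of its points is a conjugate**: if `w₁ ∪ w₂` is closed at `x`, then the word `w₂ ∪ w₁` from `x + disp w₁` has holonomy
`V(w₁)⁻¹ V(w₁ ∪ w₂) V(w₁)` ((9): `V(Γ₁ ∪ Γ₂) = V(Γ₁)V(Γ₂)`). [cite: Balaban1985Averaging, (9) p.18] -/
theorem hol_rotate (V : Site d → Fin d → G) (x : Site d) (w₁ w₂ : List (Letter d)) (h : disp w₁ + disp w₂ = 0) :
    hol V (x + disp w₁) (w₂ ++ w₁) = (hol V x w₁)⁻¹ * hol V x (w₁ ++ w₂) * hol V x w₁ := by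
  rw [hol_append, hol_append, show x + disp w₁ + disp w₂ = x by rw [add_assoc, h, add_zero]]
  group

/-- **Backtracking**: `V(⟨p, p+e_τ⟩ ∪ ⟨p+e_τ, p⟩ ∪ rest) = V(rest)` ((9): `U(−b) = U(b)⁻¹`). [cite: Balaban1985Averaging, (9) p.18] -/
theorem hol_cons_true_false (V : Site d → Fin d → G) (p : Site d) (τ : Fin d) (rest : List (Letter d)) :
    hol V p ((τ, true) :: (τ, false) :: rest) = hol V p rest := by
  simp only [hol_cons, stepHol_true, stepHol_false, Letter.vec_true, Letter.vec_false, ← sub_eq_add_neg, add_sub_cancel_right,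
    mul_inv_cancel_left]

/-- **Backtracking**: `V(⟨p, p−e_τ⟩ ∪ ⟨p−e_τ, p⟩ ∪ rest) = V(rest)`. [cite: Balaban1985Averaging, (9) p.18] -/
theorem hol_cons_false_true (V : Site d → Fin d → G) (p : Site d) (τ : Fin d) (rest : List (Letter d)) :
    hol V p ((τ, false) :: (τ, true) :: rest) = hol V p rest := by
  simp only [hol_cons, stepHol_true, stepHol_false, Letter.vec_true, Letter.vec_false, ← sub_eq_add_neg, sub_add_cancel,
    inv_mul_cancel_left]

/-- `V(Γ ∪ −Γ) = 1` for a straight segment. [cite: Balaban1985Averaging, (9) p.18] -/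
theorem hol_seg_append_seg_neg (V : Site d → Fin d → G) (p : Site d) (σ : Fin d) (s : ℤ) :
    hol V p (seg σ s ++ seg σ (-s)) = 1 := by
  rw [← revWord_seg, hol_append, hol_revWord, mul_inv_cancel]

omit [Group G] in
/-- The unit segments: `seg κ 1 = ⟨e_κ⟩`. [folklore] -/
private theorem seg_one (κ : Fin d) : seg κ 1 = [(κ, true)] := rfl

omit [Group G] in
/-- The unit segments: `seg κ (−1) = ⟨−e_κ⟩`. [folklore] -/
private theorem seg_neg_one (κ : Fin d) : seg κ (-1) = [(κ, false)] := rfl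

end Words

section Squares

variable {𝔸 : Type*} [NormedRing 𝔸] [NormOneClass 𝔸]

/-- Norm form of `hol_rotate` for `U1`-valued fields: `‖V(w₂ ∪ w₁) − 1‖ ≤ ‖V(w₁ ∪ w₂) − 1‖` (conjugation by a unit of norm `≤ 1` with inverse of norm `≤ 1`).
[cite: Balaban1985Averaging, (9) p.18, p.24] -/
theorem norm_hol_rotate_sub_one_le {V : Site d → Fin d → 𝔸ˣ} (hV : ∀ x κ, V x κ ∈ U1 𝔸) (x : Site d) (w₁ w₂ : List (Letter d))
    (h : disp w₁ + disp w₂ = 0) :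
    ‖((hol V (x + disp w₁) (w₂ ++ w₁) : 𝔸ˣ) : 𝔸) - 1‖ ≤ ‖((hol V x (w₁ ++ w₂) : 𝔸ˣ) : 𝔸) - 1‖ := by
  rw [hol_rotate V x w₁ w₂ h, Units.val_mul, Units.val_mul]
  exact norm_units_inv_conj_sub_one_le (hol_mem hV x w₁) _

/-- ★ **THE EIGHT UNIT-SQUARE WORDS AT A POINT OF `S` ARE SMALL IF THE PLAQUETTES TOUCHING `S` ARE**: for `c ∈ S`, `a ≠ b` and signs `sa, sb`, the closed word
`⟨±e_a, ±e_b, ∓e_a, ∓e_b⟩` from `c` has `‖V(·) − 1‖ ≤ α` whenever `‖V(∂p) − 1‖ ≤ α` for every plaquette `p` with a corner in `S` (p. 77): each such word is a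
rotation of `∂p_{ab}(z)` or `∂p_{ba}(z)` at the square's lower corner `z`, a plaquette with the corner `c`. [cite: Balaban1985RegularSpaces, p.77 (touching convention), (1.7) p.77; Balaban1985Averaging, (9) p.18] -/
theorem norm_hol_square_sub_one_le {V : Site d → Fin d → 𝔸ˣ} (hV : ∀ x κ, V x κ ∈ U1 𝔸) {S : Set (Site d)} {α : ℝ}
    (hP : ∀ (z : Site d) (κ μ : Fin d), κ ≠ μ → PlaqTouches S z κ μ → ‖plaqF V κ μ z - 1‖ ≤ α)
    {c : Site d} (hc : c ∈ S) {a b : Fin d} (hab : a ≠ b) (sa sb : Bool) :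
    ‖((hol V c [(a, sa), (b, sb), (a, !sa), (b, !sb)] : 𝔸ˣ) : 𝔸) - 1‖ ≤ α := by
  cases sa <;> cases sb
  · -- `⟨−e_a, −e_b, e_a, e_b⟩` = `∂p_{ab}(c − e_a − e_b)` read from its corner `c`
    have h := norm_hol_rotate_sub_one_le hV (c - e a - e b) [(a, true), (b, true)] [(a, false), (b, false)]
      (by simp only [disp_cons, disp_nil, Letter.vec_true, Letter.vec_false]; abel)
    have e1 : c - e a - e b + disp [((a, true) : Letter d), (b, true)] = c := by
      simp only [disp_cons, disp_nil, Letter.vec_true]; abel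
    rw [e1] at h
    refine h.trans (hP (c - e a - e b) a b hab (Or.inr (Or.inr (Or.inr ?_))))
    have : c - e a - e b + e a + e b = c := by abel
    rw [this]; exact hc
  · -- `⟨−e_a, e_b, e_a, −e_b⟩` = `∂p_{ba}(c − e_a)` read from its corner `c`
    have h := norm_hol_rotate_sub_one_le hV (c - e a) [(b, true), (a, true), (b, false)] [(a, false)]
      (by simp only [disp_cons, disp_nil, Letter.vec_true, Letter.vec_false]; abel)
    have e1 : c - e a + disp [((b, true) : Letter d), (a, true), (b, false)] = c := by
      simp only [disp_cons, disp_nil, Letter.vec_true, Letter.vec_false]; abel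
    rw [e1] at h
    refine h.trans (hP (c - e a) b a hab.symm (Or.inr (Or.inr (Or.inl ?_))))
    rw [sub_add_cancel]; exact hc
  · -- `⟨e_a, −e_b, −e_a, e_b⟩` = `∂p_{ba}(c − e_b)` read from its corner `c`
    have h := norm_hol_rotate_sub_one_le hV (c - e b) [(b, true)] [(a, true), (b, false), (a, false)]
      (by simp only [disp_cons, disp_nil, Letter.vec_true, Letter.vec_false]; abel)
    have e1 : c - e b + disp [((b, true) : Letter d)] = c := by
      simp only [disp_cons, disp_nil, Letter.vec_true]; abel
    rw [e1] at h
    refine h.trans (hP (c - e b) b a hab.symm (Or.inr (Or.inl ?_)))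
    rw [sub_add_cancel]; exact hc
  · -- `⟨e_a, e_b, −e_a, −e_b⟩ = ∂p_{ab}(c)`
    exact hP c a b hab (Or.inl hc)

end Squares

/-! ## §2 Tree contours of two-coordinate vectors; the bond formula of the clamping gauge -/

section Clamping

variable {G : Type*} [Group G]

omit [Group G] in
/-- **The tree contour of `s e_σ + t e_τ`** (`σ ≠ τ`; `B7Prop1Explicit.treeWord` processes the coordinates in decreasing order): the segment of the LARGER
index first. [cite: Balaban1985Averaging, p.24; Balaban1984PropagatorsI, (1.7) p.18] -/
theorem treeWord_two {σ τ : Fin d} (hστ : σ ≠ τ) (s t : ℤ) :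
    treeWord (s • e σ + t • e τ : Site d) = (if τ < σ then seg σ s else []) ++ seg τ t ++ (if σ < τ then seg σ s else []) := by
  rw [treeWord_split τ]
  have hv : ∀ i, (s • e σ + t • e τ : Site d) i = (if i = σ then s else 0) + (if i = τ then t else 0) := fun i => by
    simp only [Pi.add_apply, zsmul_e_apply]
  have h1 : (s • e σ + t • e τ : Site d) τ = t := by rw [hv, if_neg (Ne.symm hστ), if_pos rfl, zero_add]
  rcases lt_or_gt_of_ne hστ with h | h
  · have hhi : hiPart τ (s • e σ + t • e τ : Site d) = 0 := by
      funext i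
      simp only [hiPart, hv, Pi.zero_apply]
      split_ifs <;> first | rfl | omega
    have hlo : loPart τ (s • e σ + t • e τ : Site d) = s • e σ := by
      funext i
      simp only [loPart, hv, zsmul_e_apply]
      split_ifs <;> first | rfl | omega
    rw [hhi, hlo, h1, treeWord_zero, treeWord_zsmul_e, if_neg (lt_asymm h), if_pos h, List.nil_append]
  · have hhi : hiPart τ (s • e σ + t • e τ : Site d) = s • e σ := by
      funext i
      simp only [hiPart, hv, zsmul_e_apply]
      split_ifs <;> first | rfl | omega
    have hlo : loPart τ (s • e σ + t • e τ : Site d) = 0 := by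
      funext i
      simp only [loPart, hv, Pi.zero_apply]
      split_ifs <;> first | rfl | omega
    rw [hhi, hlo, h1, treeWord_zero, treeWord_zsmul_e, if_pos h, if_neg (lt_asymm h), List.append_nil]

/-- **The bond formula of the clamping gauge** `w(v) = V(Γ_{π v, v})`: `V^w(x, x + e_τ) = V(Γ_{π x, x} ∪ ⟨x, x + e_τ⟩ ∪ Γ_{π(x+e_τ), x+e_τ}⁻¹)`, a word from
`π x` to `π(x + e_τ)` ((8): `V^u(x, x′) = u(x)V(x, x′)u(x′)⁻¹`; (9)). [cite: Balaban1985Averaging, (8)–(9) p.18, p.24] -/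
theorem clampGauge_bond (V : Site d → Fin d → G) {lo hi : Site d} {w : Site d → G}
    (hw : ∀ v, w v = hol V (clamp lo hi v) (treeWord (v - clamp lo hi v))) (x : Site d) (τ : Fin d) :
    gaugeAct w V x τ =
      hol V (clamp lo hi x) (treeWord (x - clamp lo hi x) ++ (τ, true) :: revWord (treeWord (x + e τ - clamp lo hi (x + e τ)))) := by
  have e1 : clamp lo hi x + (x - clamp lo hi x) = x := by abel
  rw [hol_append, disp_treeWord, e1, hol_cons, stepHol_true, Letter.vec_true,
    hol_revWord' V (x := clamp lo hi (x + e τ)) (x + e τ) (treeWord (x + e τ - clamp lo hi (x + e τ))) (by rw [disp_treeWord]; abel)]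
  simp only [gaugeAct, hw, mul_assoc]

end Clamping

/-! ## §3 Geometry: the sides of the plaquettes touching a box, and their clamped images -/

section Geometry

/-- **A side of a plaquette touching `S`, in coordinates**: if `⟨x, x + e_τ⟩` is a side of a plaquette `p_{κν}(z)` with a corner `q ∈ S`, then for the other
direction `σ ∈ {κ, ν} ∖ {τ}`: `x` agrees with `q` off `{σ, τ}`, `|x_σ − q_σ| ≤ 1`, and `x_τ ∈ {q_τ − 1, q_τ}`. [cite: Balaban1985RegularSpaces, p.77 (touching convention), (1.2) p.76 (p_{μν}(x))] -/
theorem exists_corner_of_sideTouches {S : Set (Site d)} {x : Site d} {τ : Fin d} (h : SideTouches S x τ) :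
    ∃ σ, σ ≠ τ ∧ ∃ q ∈ S, (∀ i, i ≠ σ → i ≠ τ → x i = q i) ∧ (q σ - 1 ≤ x σ ∧ x σ ≤ q σ + 1) ∧ (q τ - 1 ≤ x τ ∧ x τ ≤ q τ) := by
  obtain ⟨z, κ, ν, hκν, hp, hs⟩ := h
  rcases hs with ⟨rfl, rfl⟩ | ⟨rfl, rfl⟩ | ⟨rfl, rfl⟩ | ⟨rfl, rfl⟩
  · -- the side `⟨z, z + e_κ⟩`: `σ = ν`
    rcases hp with hq | hq | hq | hq <;> refine ⟨ν, hκν.symm, _, hq, fun i h1 h2 => ?_, ?_, ?_⟩ <;> clear hq <;>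
      (try simp only [Pi.add_apply, e_apply]) <;> (try split_ifs) <;> omega
  · -- the side `⟨z + e_κ, z + e_κ + e_ν⟩`: `σ = κ`
    rcases hp with hq | hq | hq | hq <;> refine ⟨κ, hκν, _, hq, fun i h1 h2 => ?_, ?_, ?_⟩ <;> clear hq <;>
      (try simp only [Pi.add_apply, e_apply]) <;> (try split_ifs) <;> omega
  · -- the side `⟨z + e_ν, z + e_ν + e_κ⟩`: `σ = ν`
    rcases hp with hq | hq | hq | hq <;> refine ⟨ν, hκν.symm, _, hq, fun i h1 h2 => ?_, ?_, ?_⟩ <;> clear hq <;>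
      (try simp only [Pi.add_apply, e_apply]) <;> (try split_ifs) <;> omega
  · -- the side `⟨z, z + e_ν⟩`: `σ = κ`
    rcases hp with hq | hq | hq | hq <;> refine ⟨κ, hκν, _, hq, fun i h1 h2 => ?_, ?_, ?_⟩ <;> clear hq <;>
      (try simp only [Pi.add_apply, e_apply]) <;> (try split_ifs) <;> omega

/-- ★ **CLAMPED IMAGES OF A SIDE OF A TOUCHING PLAQUETTE (box `□ = [lo, hi]`, retraction `π = clamp lo hi`)**: for a side `⟨x, x + e_τ⟩` of a plaquette with a
corner in `□` there are `σ ≠ τ` and `s ∈ {−1, 0, 1}` with EITHER `x − π x = s e_σ` and `π(x + e_τ) = π x + e_τ` (the bond runs along `□` in direction `τ`), OR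
`x − π x = s e_σ − e_τ` and `π(x + e_τ) = π x` (it enters `□`'s slab from below), OR `x − π x = s e_σ`, `π(x + e_τ) = π x` (it leaves the slab upward).
[cite: Balaban1985RegularSpaces, p.77 (touching convention); Balaban1985Averaging, p.24] -/
theorem clamp_trichotomy {lo hi : Site d} (hlohi : ∀ i, lo i ≤ hi i) {x : Site d} {τ : Fin d} (h : SideTouches {y | InBox lo hi y} x τ) :
    ∃ σ, σ ≠ τ ∧ ∃ s : ℤ, (s = -1 ∨ s = 0 ∨ s = 1) ∧
      ((x - clamp lo hi x = s • e σ ∧ clamp lo hi (x + e τ) = clamp lo hi x + e τ) ∨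
        (x - clamp lo hi x = s • e σ - e τ ∧ clamp lo hi (x + e τ) = clamp lo hi x) ∨
        (x - clamp lo hi x = s • e σ ∧ clamp lo hi (x + e τ) = clamp lo hi x)) := by
  obtain ⟨σ, hστ, q, hq, hoff, hσ, hτ⟩ := exists_corner_of_sideTouches h
  have hq' : ∀ i, lo i ≤ q i ∧ q i ≤ hi i := hq
  refine ⟨σ, hστ, x σ - clamp lo hi x σ, ?_, ?_⟩
  · have h1 := hq' σ
    simp only [clamp, max_def, min_def]
    split_ifs <;> omega
  -- the coordinates off `{σ, τ}` are not moved by `π`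
  have hoffc : ∀ i, i ≠ σ → i ≠ τ → clamp lo hi x i = x i := fun i h1 h2 => by
    have := hq' i; have := hoff i h1 h2
    simp only [clamp, max_def, min_def]
    split_ifs <;> omega
  by_cases hA : lo τ ≤ x τ ∧ x τ < hi τ
  · -- along the box in direction `τ`
    refine Or.inl ⟨funext fun i => ?_, clamp_add_e_of hA⟩
    by_cases hiσ : i = σ
    · subst hiσ; rw [Pi.sub_apply, zsmul_e_apply, if_pos rfl]
    · by_cases hiτ : i = τ
      · subst hiτ
        simp only [Pi.sub_apply, zsmul_e_apply, if_neg hiσ, clamp, max_def, min_def]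
        split_ifs <;> omega
      · simp only [Pi.sub_apply, zsmul_e_apply, if_neg hiσ, hoffc i hiσ hiτ, sub_self]
  · have hcl : clamp lo hi (x + e τ) = clamp lo hi x := clamp_add_e_of_not (hlohi τ) hA
    have hqτ := hq' τ
    rcases (show x τ = q τ ∨ x τ = q τ - 1 by omega) with hxq | hxq
    · -- `x_τ = q_τ = hi_τ`: leaving upward; `π` does not move the `τ`-coordinate of `x`
      refine Or.inr (Or.inr ⟨funext fun i => ?_, hcl⟩)
      by_cases hiσ : i = σ
      · subst hiσ; rw [Pi.sub_apply, zsmul_e_apply, if_pos rfl]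
      · by_cases hiτ : i = τ
        · subst hiτ
          simp only [Pi.sub_apply, zsmul_e_apply, if_neg hiσ, clamp, max_def, min_def]
          split_ifs <;> omega
        · simp only [Pi.sub_apply, zsmul_e_apply, if_neg hiσ, hoffc i hiσ hiτ, sub_self]
    · -- `x_τ = q_τ − 1 = lo_τ − 1`: entering from below
      refine Or.inr (Or.inl ⟨funext fun i => ?_, hcl⟩)
      by_cases hiσ : i = σ
      · subst hiσ; rw [Pi.sub_apply, Pi.sub_apply, zsmul_e_apply, if_pos rfl, e_apply, if_neg hστ, sub_zero]
      · by_cases hiτ : i = τ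
        · subst hiτ
          simp only [Pi.sub_apply, zsmul_e_apply, e_apply, if_neg hiσ, if_true, clamp, max_def, min_def]
          split_ifs <;> omega
        · simp only [Pi.sub_apply, zsmul_e_apply, e_apply, if_neg hiσ, if_neg hiτ, hoffc i hiσ hiτ, sub_self]

end Geometry

/-! ## §4 The clamping gauge controls the sides of the touching plaquettes; the layer gauge -/

section LayerGauge

variable {𝔸 : Type*} [NormedRing 𝔸] [NormOneClass 𝔸]

/-- ★★ **THE CLAMPING GAUGE CONTROLS EVERY SIDE OF EVERY PLAQUETTE TOUCHING THE BOX**: let `V` be `U1`-valued with `‖V(∂p) − 1‖ ≤ α` for the plaquettes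
with a corner in `□ = [lo, hi]` and `‖V(b) − 1‖ ≤ β` for the bonds with both end-points in `□`, and let `w(v) = V(Γ_{π v, v})`.  Then `‖V^w(b) − 1‖ ≤ α + β`
for every side `b` of a plaquette touching `□`: by `clamp_trichotomy` and `clampGauge_bond`, `V^w(b)` is a backtracking word (`= 1`), or a unit square at the
point `π x ∈ □` (`norm_hol_square_sub_one_le`) times a bond of `□` or `1`. [cite: Balaban1985RegularSpaces, Lemma 1 p.79, p.77; Balaban1985Averaging, p.24, (8)–(9) p.18] -/
theorem norm_clampGauge_sub_one_le {V : Site d → Fin d → 𝔸ˣ} (hV : ∀ x κ, V x κ ∈ U1 𝔸) {lo hi : Site d} (hlohi : ∀ i, lo i ≤ hi i)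
    {α β : ℝ} (hα : 0 ≤ α) (hβ : 0 ≤ β)
    (hP : ∀ (z : Site d) (κ μ : Fin d), κ ≠ μ → PlaqTouches {y | InBox lo hi y} z κ μ → ‖plaqF V κ μ z - 1‖ ≤ α)
    (hin : ∀ (y : Site d) (κ : Fin d), InBox lo hi y → InBox lo hi (y + e κ) → ‖((V y κ : 𝔸ˣ) : 𝔸) - 1‖ ≤ β)
    {w : Site d → 𝔸ˣ} (hw : ∀ v, w v = hol V (clamp lo hi v) (treeWord (v - clamp lo hi v)))
    {x : Site d} {τ : Fin d} (hst : SideTouches {y | InBox lo hi y} x τ) :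
    ‖((gaugeAct w V x τ : 𝔸ˣ) : 𝔸) - 1‖ ≤ α + β := by
  have hcx : clamp lo hi x ∈ {y | InBox lo hi y} := clamp_inBox hlohi x
  have h1 : ‖((1 : 𝔸ˣ) : 𝔸) - 1‖ ≤ α + β := by rw [Units.val_one, sub_self, norm_zero]; positivity
  obtain ⟨σ, hστ, s, hs, hcase⟩ := clamp_trichotomy hlohi hst
  rw [clampGauge_bond V hw x τ]
  set c := clamp lo hi x with hc
  -- the sign letter of `s ≠ 0`
  have hsgn : s ≠ 0 → ∃ b : Bool, seg σ s = [(σ, b)] ∧ seg σ (-s) = [(σ, !b)] := fun hs0 => by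
    rcases hs with rfl | rfl | rfl
    · exact ⟨false, rfl, rfl⟩
    · exact absurd rfl hs0
    · exact ⟨true, rfl, rfl⟩
  rcases hcase with ⟨hxc, hcl⟩ | ⟨hxc, hcl⟩ | ⟨hxc, hcl⟩
  · -- along the box: `W = seg σ s ∪ ⟨x, x+e_τ⟩ ∪ seg σ (−s)` = (square or nothing) × the box bond `⟨π x, π x + e_τ⟩`
    have hW : x + e τ - clamp lo hi (x + e τ) = s • e σ := by rw [hcl, ← hxc]; abel
    rw [hxc, hW, treeWord_zsmul_e, revWord_seg]
    have hbond : ‖((V c τ : 𝔸ˣ) : 𝔸) - 1‖ ≤ β := hin c τ hcx (by rw [hc, ← hcl]; exact clamp_inBox hlohi _)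
    -- `V(W) = V(W ∪ ⟨π x + e_τ, π x⟩) · V(π x, τ)`
    have hsplit : hol V c (seg σ s ++ (τ, true) :: seg σ (-s)) = hol V c (seg σ s ++ (τ, true) :: seg σ (-s) ++ [(τ, false)]) * V c τ := by
      rw [hol_append _ _ (seg σ s ++ (τ, true) :: seg σ (-s)) [(τ, false)], hol_cons, hol_nil, mul_one, stepHol_false]
      have : c + disp (seg σ s ++ (τ, true) :: seg σ (-s)) - e τ = c := by
        simp only [disp_append, disp_cons, disp_seg, Letter.vec_true, neg_smul]; abel
      rw [this, mul_assoc, inv_mul_cancel, mul_one]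
    rw [hsplit, Units.val_mul]
    rcases eq_or_ne s 0 with rfl | hs0
    · simp only [seg_zero, neg_zero, List.nil_append]
      rw [show hol V c ((τ, true) :: ([] : List (Letter d)) ++ [(τ, false)]) = 1 from hol_cons_true_false V c τ [], Units.val_one, one_mul]
      exact hbond.trans (by linarith)
    · obtain ⟨b, hb1, hb2⟩ := hsgn hs0
      rw [hb1, hb2]
      have hsq := norm_hol_square_sub_one_le hV hP hcx hστ b true
      have hn1 : ‖((hol V c [(σ, b), (τ, true), (σ, !b), (τ, !true)] : 𝔸ˣ) : 𝔸)‖ ≤ 1 := (mem_U1.mp (hol_mem hV _ _)).1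
      exact (B8Ineq170.norm_mul_sub_one_le_of_norm_le_one hn1).trans (add_le_add hsq hbond)
  · -- entering from below: `W` is closed at `π x`; `W = ⟨−e_τ⟩ ∪ seg σ s ∪ ⟨e_τ⟩ ∪ seg σ (−s)` (a square) if `σ < τ`, a backtrack if `τ < σ`
    have hW : x + e τ - clamp lo hi (x + e τ) = s • e σ := by
      rw [hcl]
      calc x + e τ - c = (x - c) + e τ := by abel
        _ = s • e σ := by rw [hxc]; abel
    rw [hxc, hW, treeWord_zsmul_e, revWord_seg, show (s • e σ - e τ : Site d) = s • e σ + (-1 : ℤ) • e τ by rw [neg_one_zsmul, sub_eq_add_neg],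
      treeWord_two hστ, seg_neg_one]
    rcases lt_or_gt_of_ne hστ with hlt | hgt
    · rw [if_neg (lt_asymm hlt), if_pos hlt, List.nil_append]
      rcases eq_or_ne s 0 with rfl | hs0
      · simp only [seg_zero, neg_zero, List.append_nil, List.singleton_append]
        rw [hol_cons_false_true, hol_nil]
        exact h1
      · obtain ⟨b, hb1, hb2⟩ := hsgn hs0
        rw [hb1, hb2]
        exact (norm_hol_square_sub_one_le hV hP hcx (Ne.symm hστ) false b).trans (by linarith)
    · rw [if_pos hgt, if_neg (lt_asymm hgt), List.append_nil, List.append_assoc, List.singleton_append, hol_append,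
        hol_cons_false_true, ← hol_append, hol_seg_append_seg_neg]
      exact h1
  · -- leaving upward: `W = seg σ s ∪ ⟨e_τ⟩ ∪ (Γ(s e_σ + e_τ))⁻¹`, a square if `σ < τ`, a backtrack if `τ < σ`
    have hW : x + e τ - clamp lo hi (x + e τ) = s • e σ + (1 : ℤ) • e τ := by rw [hcl, one_zsmul, ← hxc]; abel
    rw [hxc, hW, treeWord_zsmul_e, treeWord_two hστ, seg_one]
    rcases lt_or_gt_of_ne hστ with hlt | hgt
    · rw [if_neg (lt_asymm hlt), if_pos hlt, List.nil_append, revWord_append, revWord_seg,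
        show revWord [((τ, true) : Letter d)] = [(τ, false)] from rfl]
      rcases eq_or_ne s 0 with rfl | hs0
      · simp only [seg_zero, neg_zero, List.nil_append]
        rw [hol_cons_true_false, hol_nil]
        exact h1
      · obtain ⟨b, hb1, hb2⟩ := hsgn hs0
        rw [hb1, hb2]
        exact (norm_hol_square_sub_one_le hV hP hcx hστ b true).trans (by linarith)
    · rw [if_pos hgt, if_neg (lt_asymm hgt), List.append_nil, revWord_append, revWord_seg,
        show revWord [((τ, true) : Letter d)] = [(τ, false)] from rfl, List.singleton_append, hol_append, hol_cons_true_false,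
        ← hol_append, hol_seg_append_seg_neg]
      exact h1

/-- `(u₂ · u₁)`-gauge = `u₂`-gauge after `u₁`-gauge ((8); the `B7Prop1Explicit`-carrier twin of `T4MultilevelCombGauge.gaugeAct_mul`, kept private).
[cite: Balaban1985Averaging, (8) p.18] -/
private theorem gaugeAct_mul {G : Type*} [Group G] (u₂ u₁ : Site d → G) (V : Site d → Fin d → G) :
    gaugeAct (u₂ * u₁) V = gaugeAct u₂ (gaugeAct u₁ V) := by
  funext x κ
  simp only [gaugeAct, Pi.mul_apply, mul_inv_rev, mul_assoc]

/-- ★★ **THE LAYER AXIAL GAUGE**: for a `U1`-valued `U` valued in a subgroup `H` and a box `□ = [lo, hi]`, if `‖U(∂p) − 1‖ ≤ α` for every plaquette with a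
corner in `□` (p. 77's «p ∈ □»), there is an `H`-valued (and `U1`-valued) gauge transformation `u` with `‖U^u(b) − 1‖ ≤ (|hi − lo|₁ + 1)·α` on every side `b`
of every plaquette touching `□` — Lemma 1's axial gauge `v₀` based at `lo` (`axial_bond_bound_sharp`: the bonds of `□` within `|hi − lo|₁·α`, using the
plaquettes INSIDE `□` only) followed by the clamping gauge of `U^{v₀}` (`norm_clampGauge_sub_one_le`; plaquette smallness is gauge invariant, (1.11)).
[cite: Balaban1985RegularSpaces, Lemma 1 p.79, (1.11) p.78, p.77; Balaban1985Averaging, p.24] -/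
theorem exists_layerGauge {V : Site d → Fin d → 𝔸ˣ} (hV : ∀ x κ, V x κ ∈ U1 𝔸) {H : Subgroup 𝔸ˣ} (hVH : ∀ x κ, V x κ ∈ H)
    {lo hi : Site d} (hlohi : ∀ i, lo i ≤ hi i) {α : ℝ} (hα : 0 ≤ α)
    (hP : ∀ (z : Site d) (κ μ : Fin d), κ ≠ μ → PlaqTouches {y | InBox lo hi y} z κ μ → ‖plaqF V κ μ z - 1‖ ≤ α) :
    ∃ u : Site d → 𝔸ˣ, (∀ x, u x ∈ H) ∧ (∀ x, u x ∈ U1 𝔸) ∧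
      ∀ (x : Site d) (τ : Fin d), SideTouches {y | InBox lo hi y} x τ → ‖((gaugeAct u V x τ : 𝔸ˣ) : 𝔸) - 1‖ ≤ ((l1 (hi - lo) : ℝ) + 1) * α := by
  -- stage 1: Lemma 1's axial gauge on the box
  set v₀ : Site d → 𝔸ˣ := axialFn V lo with hv₀
  have hv₀U : ∀ x, v₀ x ∈ U1 𝔸 := fun x => axialFn_mem hV lo x
  have hv₀H : ∀ x, v₀ x ∈ H := fun x => hol_mem_of hVH _ _
  set V₁ : Site d → Fin d → 𝔸ˣ := gaugeAct v₀ V with hV₁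
  have hV₁U : ∀ x κ, V₁ x κ ∈ U1 𝔸 := fun x κ => gaugeAct_mem hV hv₀U x κ
  have hV₁H : ∀ x κ, V₁ x κ ∈ H := fun x κ => gaugeAct_mem_of hVH hv₀H x κ
  have hPS : B8Lemma1NonAbelian.PlaqSmall V lo hi α := by
    intro z κ μ hκμ hlo hhi
    refine hP z κ μ hκμ (Or.inl fun i => ⟨hlo i, ?_⟩)
    have h1 := hhi i
    simp only [Pi.add_apply, e_apply] at h1
    split_ifs at h1 <;> omega
  have hin : ∀ (y : Site d) (κ : Fin d), InBox lo hi y → InBox lo hi (y + e κ) → ‖((V₁ y κ : 𝔸ˣ) : 𝔸) - 1‖ ≤ (l1 (hi - lo) : ℝ) * α := by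
    intro y κ hy hyκ
    have hloy : lo ≤ y := fun i => (hy i).1
    have hb := axial_bond_bound_sharp V hV hPS lo y κ le_rfl hloy (fun i => (hyκ i).2)
    have hl1 : (l1 (lowPart κ (y - lo)) : ℝ) ≤ l1 (hi - lo) := by
      have h0 : 0 ≤ y - lo := sub_nonneg.mpr hloy
      have hle : lowPart κ (y - lo) ≤ hi - lo := (B8Lemma1NonAbelian.lowPart_le_self κ h0).trans fun i => by
        simp only [Pi.sub_apply]; linarith [(hy i).2]
      have hnn := B8Lemma1NonAbelian.lowPart_nonneg κ h0
      unfold l1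
      exact_mod_cast Finset.sum_le_sum fun i _ => by
        have a1 : 0 ≤ lowPart κ (y - lo) i := hnn i
        have a2 : lowPart κ (y - lo) i ≤ (hi - lo) i := hle i
        have : ((lowPart κ (y - lo) i).natAbs : ℤ) ≤ (((hi - lo) i).natAbs : ℤ) := by
          rw [Int.natAbs_of_nonneg a1, Int.natAbs_of_nonneg (a1.trans a2)]; exact a2
        exact_mod_cast this
    exact hb.trans (mul_le_mul_of_nonneg_right hl1 hα)
  have hP₁ : ∀ (z : Site d) (κ μ : Fin d), κ ≠ μ → PlaqTouches {y | InBox lo hi y} z κ μ → ‖plaqF V₁ κ μ z - 1‖ ≤ α := by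
    intro z κ μ hκμ hpt
    have := hP z κ μ hκμ hpt
    unfold plaqF at this ⊢
    rwa [hV₁, B7AvgGaugeCovariance.norm_hol_gaugeAct_plaqWord hv₀U]
  -- stage 2: the clamping gauge of `V₁`
  obtain ⟨w, hw⟩ : ∃ w : Site d → 𝔸ˣ, w = fun v => hol V₁ (clamp lo hi v) (treeWord (v - clamp lo hi v)) := ⟨_, rfl⟩
  have hw' : ∀ v, w v = hol V₁ (clamp lo hi v) (treeWord (v - clamp lo hi v)) := fun v => by rw [hw]
  refine ⟨w * v₀, fun x => H.mul_mem (by rw [hw']; exact hol_mem_of hV₁H _ _) (hv₀H x),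
    fun x => (U1 𝔸).mul_mem (by rw [hw']; exact hol_mem hV₁U _ _) (hv₀U x), fun x τ hst => ?_⟩
  rw [gaugeAct_mul, ← hV₁]
  have := norm_clampGauge_sub_one_le hV₁U hlohi hα (by positivity) hP₁ hin hw' hst
  linarith

end LayerGauge

/-! ## §5 The transfer schema: uniform ball + gauge covariance + locality on the touching sides ⟹ p. 77's class at `Ω₀ = □` -/

section Schema

variable {𝔸 : Type*} [NormedRing 𝔸] [NormOneClass 𝔸]

/-- ★★★ **THE TRANSFER SCHEMA.**  Let `H ≤ U1` be a subgroup, `□ = [lo, hi]` a box and `P` a property of bond fields such that (BG) for some `δ > 0`, `P(V^u)`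
holds for every `U1`-valued gauge transformation `u` and every `H`-valued `V` with `‖V(b) − 1‖ ≤ δ` on ALL bonds, and (L) `P` passes between `H`-valued fields
agreeing on the sides of the plaquettes touching `□`.  Then EVERY `H`-valued `U` with `‖U(∂p) − 1‖ ≤ δ∕(|hi − lo|₁ + 1)` for the plaquettes touching `□` (p. 77:
`U ∈ 𝔄` at `Ω₀ = □`, level `0`) has `P`.  PROOF: the layer gauge `u` (`exists_layerGauge`); `V :=` `U^u` on those sides, `1` elsewhere, is `H`-valued and
uniformly `δ`-close; `P(V^{u⁻¹})` by (BG); `V^{u⁻¹} = U` on the sides, so `P(U)` by (L). [cite: Balaban1985RegularSpaces, p.77, (1.7) p.77, (1.11) p.78, Lemma 1 p.79; Balaban1985Averaging, p.24, (8) p.18] -/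
theorem of_touching_plaquettes {H : Subgroup 𝔸ˣ} (hH : H ≤ U1 𝔸) {lo hi : Site d} (hlohi : ∀ i, lo i ≤ hi i)
    {P : (Site d → Fin d → 𝔸ˣ) → Prop}
    (hBG : ∃ δ : ℝ, 0 < δ ∧ ∀ (u : Site d → 𝔸ˣ), (∀ x, u x ∈ U1 𝔸) → ∀ (V : Site d → Fin d → 𝔸ˣ), (∀ x κ, V x κ ∈ H) →
      (∀ x κ, ‖((V x κ : 𝔸ˣ) : 𝔸) - 1‖ ≤ δ) → P (gaugeAct u V))
    (hL : ∀ (U U' : Site d → Fin d → 𝔸ˣ), (∀ x κ, U x κ ∈ H) → (∀ x κ, U' x κ ∈ H) →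
      (∀ (y : Site d) (τ : Fin d), SideTouches {z | InBox lo hi z} y τ → U y τ = U' y τ) → P U → P U') :
    ∃ α : ℝ, 0 < α ∧ ∀ (U : Site d → Fin d → 𝔸ˣ), (∀ x κ, U x κ ∈ H) →
      (∀ (z : Site d) (κ μ : Fin d), κ ≠ μ → PlaqTouches {y | InBox lo hi y} z κ μ → ‖plaqF U κ μ z - 1‖ ≤ α) → P U := by
  classical
  obtain ⟨δ, hδ, hB⟩ := hBG
  refine ⟨δ / ((l1 (hi - lo) : ℝ) + 1), by positivity, fun U hUH hP => ?_⟩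
  have hU : ∀ x κ, U x κ ∈ U1 𝔸 := fun x κ => hH (hUH x κ)
  obtain ⟨u, huH, huU, hclose⟩ := exists_layerGauge hU hUH hlohi (by positivity) hP
  have hδ' : ((l1 (hi - lo) : ℝ) + 1) * (δ / ((l1 (hi - lo) : ℝ) + 1)) = δ := by field_simp
  -- the cut-off of `U^u` to the sides of the touching plaquettes
  obtain ⟨V, hV⟩ : ∃ V : Site d → Fin d → 𝔸ˣ, V = fun x κ => if SideTouches {z | InBox lo hi z} x κ then gaugeAct u U x κ else 1 := ⟨_, rfl⟩
  have hVH : ∀ x κ, V x κ ∈ H := by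
    intro x κ; rw [hV]; dsimp only; split_ifs
    · exact gaugeAct_mem_of hUH huH x κ
    · exact H.one_mem
  have hVδ : ∀ x κ, ‖((V x κ : 𝔸ˣ) : 𝔸) - 1‖ ≤ δ := by
    intro x κ; rw [hV]; dsimp only; split_ifs with hst
    · rw [← hδ']; exact hclose x κ hst
    · rw [Units.val_one, sub_self, norm_zero]; exact hδ.le
  have hPV := hB u⁻¹ (fun x => (U1 𝔸).inv_mem (huU x)) V hVH hVδ
  refine hL _ U (fun x κ => gaugeAct_mem_of hVH (fun y => H.inv_mem (huH y)) x κ) hUH (fun y τ hst => ?_) hPV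
  rw [hV]
  simp only [gaugeAct, if_pos hst]
  group

end Schema

/-! ## §6 The schema with the gauge transformation valued in `H`, and with the three legs separated -/

section SchemaLegs

variable {𝔸 : Type*} [NormedRing 𝔸] [NormOneClass 𝔸]

/-- ★★★ **THE TRANSFER SCHEMA, the gauge transformation of (BG) valued in `H`**: as `of_touching_plaquettes`, but (BG) is asked only for `H`-valued `u` (the layer
gauge of `exists_layerGauge` IS `H`-valued, so the same proof applies).  [cite: Balaban1985RegularSpaces, p.77, (1.7) p.77, (1.11) p.78, Lemma 1 p.79; Balaban1985Averaging, p.24, (8) p.18] -/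
theorem of_touching_plaquettes_H {H : Subgroup 𝔸ˣ} (hH : H ≤ U1 𝔸) {lo hi : Site d} (hlohi : ∀ i, lo i ≤ hi i)
    {P : (Site d → Fin d → 𝔸ˣ) → Prop}
    (hBG : ∃ δ : ℝ, 0 < δ ∧ ∀ (u : Site d → 𝔸ˣ), (∀ x, u x ∈ H) → ∀ (V : Site d → Fin d → 𝔸ˣ), (∀ x κ, V x κ ∈ H) →
      (∀ x κ, ‖((V x κ : 𝔸ˣ) : 𝔸) - 1‖ ≤ δ) → P (gaugeAct u V))
    (hL : ∀ (U U' : Site d → Fin d → 𝔸ˣ), (∀ x κ, U x κ ∈ H) → (∀ x κ, U' x κ ∈ H) →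
      (∀ (y : Site d) (τ : Fin d), SideTouches {z | InBox lo hi z} y τ → U y τ = U' y τ) → P U → P U') :
    ∃ α : ℝ, 0 < α ∧ ∀ (U : Site d → Fin d → 𝔸ˣ), (∀ x κ, U x κ ∈ H) →
      (∀ (z : Site d) (κ μ : Fin d), κ ≠ μ → PlaqTouches {y | InBox lo hi y} z κ μ → ‖plaqF U κ μ z - 1‖ ≤ α) → P U := by
  classical
  obtain ⟨δ, hδ, hB⟩ := hBG
  refine ⟨δ / ((l1 (hi - lo) : ℝ) + 1), by positivity, fun U hUH hP => ?_⟩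
  have hU : ∀ x κ, U x κ ∈ U1 𝔸 := fun x κ => hH (hUH x κ)
  obtain ⟨u, huH, -, hclose⟩ := exists_layerGauge hU hUH hlohi (by positivity) hP
  have hδ' : ((l1 (hi - lo) : ℝ) + 1) * (δ / ((l1 (hi - lo) : ℝ) + 1)) = δ := by field_simp
  obtain ⟨V, hV⟩ : ∃ V : Site d → Fin d → 𝔸ˣ, V = fun x κ => if SideTouches {z | InBox lo hi z} x κ then gaugeAct u U x κ else 1 := ⟨_, rfl⟩
  have hVH : ∀ x κ, V x κ ∈ H := by
    intro x κ; rw [hV]; dsimp only; split_ifs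
    · exact gaugeAct_mem_of hUH huH x κ
    · exact H.one_mem
  have hVδ : ∀ x κ, ‖((V x κ : 𝔸ˣ) : 𝔸) - 1‖ ≤ δ := by
    intro x κ; rw [hV]; dsimp only; split_ifs with hst
    · rw [← hδ']; exact hclose x κ hst
    · rw [Units.val_one, sub_self, norm_zero]; exact hδ.le
  have hPV := hB u⁻¹ (fun x => H.inv_mem (huH x)) V hVH hVδ
  refine hL _ U (fun x κ => gaugeAct_mem_of hVH (fun y => H.inv_mem (huH y)) x κ) hUH (fun y τ hst => ?_) hPV
  rw [hV]
  simp only [gaugeAct, if_pos hst]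
  group

/-- ★★★ **THE TRANSFER SCHEMA WITH THE THREE LEGS SEPARATED** — (B) a uniform ball: `P V` for every `H`-valued `V` with `‖V(b) − 1‖ ≤ δ` on all bonds;
(G) pull-back along gauge transformations: `P(U^u) → P(U)` for `H`-valued `u`, `U`; (L) locality on the sides of the plaquettes touching `□`.  Then every
`H`-valued `U` whose plaquettes touching `□` are `δ∕(|hi − lo|₁ + 1)`-small has `P` ((B) + (G) give (BG): `V = (V^u)^{u⁻¹}`).  This is the shape of the
cell's N06 «IDEA-3.11 (iv)» schema (uniform ball + orbit invariance + locality) with the locality leg on `SideTouches` instead of a box.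
[cite: Balaban1985RegularSpaces, p.77, (1.7) p.77, (1.11) p.78, Lemma 1 p.79; Balaban1985Averaging, p.24, (8) p.18] -/
theorem of_touching_plaquettes_BGL {H : Subgroup 𝔸ˣ} (hH : H ≤ U1 𝔸) {lo hi : Site d} (hlohi : ∀ i, lo i ≤ hi i)
    {P : (Site d → Fin d → 𝔸ˣ) → Prop}
    (hB : ∃ δ : ℝ, 0 < δ ∧ ∀ (V : Site d → Fin d → 𝔸ˣ), (∀ x κ, V x κ ∈ H) → (∀ x κ, ‖((V x κ : 𝔸ˣ) : 𝔸) - 1‖ ≤ δ) → P V)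
    (hG : ∀ (u : Site d → 𝔸ˣ), (∀ x, u x ∈ H) → ∀ (U : Site d → Fin d → 𝔸ˣ), (∀ x κ, U x κ ∈ H) → P (gaugeAct u U) → P U)
    (hL : ∀ (U U' : Site d → Fin d → 𝔸ˣ), (∀ x κ, U x κ ∈ H) → (∀ x κ, U' x κ ∈ H) →
      (∀ (y : Site d) (τ : Fin d), SideTouches {z | InBox lo hi z} y τ → U y τ = U' y τ) → P U → P U') :
    ∃ α : ℝ, 0 < α ∧ ∀ (U : Site d → Fin d → 𝔸ˣ), (∀ x κ, U x κ ∈ H) →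
      (∀ (z : Site d) (κ μ : Fin d), κ ≠ μ → PlaqTouches {y | InBox lo hi y} z κ μ → ‖plaqF U κ μ z - 1‖ ≤ α) → P U := by
  obtain ⟨δ, hδ, hB⟩ := hB
  refine of_touching_plaquettes_H hH hlohi ⟨δ, hδ, fun u hu V hV hVδ => ?_⟩ hL
  have hinv : gaugeAct u⁻¹ (gaugeAct u V) = V := by
    funext x κ
    simp only [gaugeAct, Pi.inv_apply, inv_inv]
    group
  have h := hG u⁻¹ (fun x => H.inv_mem (hu x)) (gaugeAct u V) (fun x κ => gaugeAct_mem_of hV hu x κ)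
  rw [hinv] at h
  exact h (hB V hV hVδ)

end SchemaLegs

end Literature.MathematicalPhysics.QuantumFieldTheory.Balaban1983to89.B8LayerAxialGauge

end
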